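import Literature.NumberTheory.EllipticCurves.Rank1Residual.Typed.Basic
import HarnessLib

/-!
# Class X4 (additive `p`, irreducible `E[p]`) — TYPED missing input (cell `b2b-bsdres`)

HONEST FRAMING (run/shared/lean/b2b/bsd-rank1-residual/): construction-shaped classes are TYPED
(missing input named; required output at `(E,p)` stated), NOT attempted; this is not "finishing BSD".

**Class X4** (RESIDUAL-CASES §a.2 v3; `Rank1Residual.ClassX4 W p := p ≠ 2 ∧ Addv W p ∧ Irr W p`):
odd `p` of additive reduction with `E[p]` irreducible; both ranks. Census v3: 58 pairs on 56 curves
with `N < 2500` (35 at `p = 3`), 561 on 470 curves with `N < 10⁴`. Label: CONSTRUCTION-SHAPED.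

**What kind of object is missing.** A `p`-adic `L`-function / control theorem at an ADDITIVE prime
making an Iwasawa main conjecture yield the leading term: there is no ordinary or signed local
condition at additive `p`; potentially good reduction becomes good only after a ramified base change
`F/ℚ`, and the `p`-part of BSD over a totally real `F` at primes above `p` with ramification index
`e > 1` is not in print (the 2026 preprint H. Li, arXiv:2608.11969, treats a SEMISTABLE curve over
`F` and is conditional on the IMC "along with a substantial number of assumptions").

**Closest published results, verbatim, and why they do not reach the class.**
* C.-H. Kim, *The structure of Selmer groups and the Iwasawa main conjecture for elliptic curves*,
  Amer. J. Math. 148 (2026) 79–129 = arXiv:2203.12159v6, Thm. 1.8 (tree facts `Kim2022_thm11_core`,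
  `Kim2022_kuriharaNumber_certificate`, …): for `p ≥ 5`, `ρ̄` surjective, Manin constant prime to
  `p`, `ord(δ̃) < ∞`: `length Ш(E/ℚ)[p^∞] = ∂^{(ord δ̃)}(δ̃) − ∂^{(∞)}(δ̃)` — ANY reduction type.
  In analytic rank `0` this gives PER CURVE `ord_p #Ш ≤ ord_p #Ш_an + ord_p ∏ c_ℓ`, hence `BSD(E,p)`
  when `p ∤ #Ш_an · ∏ c_ℓ` (proposed census row T-KIM0, 293 pairs with `N < 10⁴`), and equality from a
  computed Kurihara number `δ̃_n` with `ord_p δ̃_n = ord_p ∏ c_ℓ` — a certificate, not a class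
  theorem; `p = 3` and non-surjective images are outside its hypotheses.
* Kim–Nakamura, J. Number Theory (2020) = arXiv:1808.07726: the numerical criterion at additive odd
  `p` under big-image hypotheses (per curve). Fouquet–Wan, arXiv:2107.13726v3 (PRE): IMC for
  universal families (Kato side) — unrefereed, and no control to the leading term.
* Heegner-index rows (Kolyvagin, GJPST 2009 Thm. 3.4 / Miller 2011 Thm. 4.4; Cha 2005; Jetchev
  2008) are reduction-type-agnostic and decide `BSD(E,p)` per curve when `ord_p I_K = 0 = ord_p #Ш_an`.

This file: `X4.MissingInputAt W p := MissingPPartAt W p` and the conditional class theorem. The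
class-wide statement is not a Literature statement; recorded in CLASSES.md.
-/

noncomputable section

open scoped Classical

open WeierstrassCurve Literature.NumberTheory.EllipticCurves
  Literature.NumberTheory.EllipticCurves.Rank1Residual

namespace Literature.NumberTheory.EllipticCurves.Rank1Residual.Typed

/-- **X4 — the missing input at `(E, p)`, typed**: at an odd additive prime with irreducible `E[p]`
no class-level `p`-part statement is in print (Kim, AJM 148 (2026) Thm. 1.8 is a per-curve
certificate for `p ≥ 5` with surjective image: in analytic rank `0` it bounds
`ord_p #Ш ≤ ord_p #Ш_an + ord_p ∏ c_ℓ` and decides the pair from a Kurihara number; Kim–Nakamura 2020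
likewise per curve; Fouquet–Wan is unrefereed), so the missing input is the whole output
`MissingPPartAt W p` — to be supplied by a `p`-adic `L`-function / control theorem at an additive
prime, not in print. Nothing asserted. [cite: Kim2022StructureSelmer, Thm. 1.8 (= arXiv v3/v4 Thm. 1.9) and §1.3.5 (shape only; nothing asserted)] -/
def X4.MissingInputAt (W : WeierstrassCurve ℚ) (p : ℕ) : Prop := MissingPPartAt W p

/-- **X4 conditional class theorem**: in analytic rank `≤ 1`, the typed missing input at an X4 pair
yields Miller's `BSD(E,p)`. [cite: Miller2011LMS, §1 and Def. 1.1] -/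
theorem X4.bsdp_of_missingInputAt (hGZK : rank_eq_analyticRank_of_analyticRank_le_one)
    (W : WeierstrassCurve ℚ) [W.IsElliptic] [W.IsGloballyMinimal] (p : ℕ) [Fact p.Prime]
    (hr : W.analyticRank ≤ 1) (_hX : ClassX4 W p) (hmiss : X4.MissingInputAt W p) : BSDp W p :=
  bsdp_of_missingPPartAt W p hGZK hr hmiss

end Literature.NumberTheory.EllipticCurves.Rank1Residual.Typed
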